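import Summits.ABC.IUTFork.Joshi.WittPrimitiveElementsPrime
import Mathlib.RingTheory.Perfectoid.Untilt
import HarnessLib

/-!
# [J-IIp] Prop. 6.2.1 (2) AT JOSHI'S LITERAL RING `𝒪_F = 𝒪_{ℂ_p}♭`: for EVERY proper ideal `𝔪 ⊂ 𝒪_{ℂ_F}♭`, every
# `0 ≠ a ∈ 𝔪` and every `j`, the ideal `([a^{j²}] − p) ⊂ 𝔸_inf(F) = W(𝒪_{ℂ_F}♭)` is PRIME — via «the tilt `𝒪_{ℂ_F}♭` is a
# valuation ring» (sharp coordinates), proof-only sequel of `Joshi/WittPrimitiveElementsPrime.lean` (block E, seat abc-iut-E-t47)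

Proof-only sequel (abc-iut cell, block E «type Joshi's construction, test vs S», rung LADDER-ABC:A2.E; seat abc-iut-E-t47) of
`Joshi/WittPrimitiveElementsPrime.lean` (p446240: `([a] − p)` is prime in `W(𝒪)` for `𝒪` a perfect valuation domain and `a` an
adically Hausdorff non-unit), typing K. Joshi, *Construction of Arithmetic Teichmüller Spaces II: Proof of a local prototype of
Mochizuki's Corollary 3.12*, arXiv:2303.01662v3 = [J-IIp] (`paper:arxiv-2303.01662`; render `HOME/lit/renders/Joshi-arxiv-2303.01662/`,
«p. N l. M» = line M of page N). Prop. 6.2.1 (2), p. 14 l. 57–59: «Each of these elements generates a principal prime ideal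
`𝔭_j = ([a^{j²}] − p) ⊂ W(𝒪_F)`», `F = ℂ♭_p` being the «typical example of interest» (p. 14 l. 48).

THE CARRIER. abc-iut-E-t62's `WittPrimitiveElementsStandardPoint.lean` (p442499) identified Joshi's `W(𝒪_F)` for `F = ℂ♭` with the
tree's `𝔸_inf(F) = 𝕎(𝒪_{ℂ_F}♭)` = `WittVector p (PreTilt (integerC F) p)` (`Literature.NumberTheory.PAdicHodge.Ainf`, any `p`-adic
local field `F`; Joshi: `F = ℚ_p`) and discharged primality on the ONE Frobenius orbit of `ker θ`. To apply p446240 at EVERY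
`a ∈ 𝔪 ∖ {0}` one needs the tilt `𝒪_{ℂ_F}♭ = PreTilt (integerC F) p` to be a VALUATION DOMAIN whose non-units are adically Hausdorff.
Mathlib has the untilt map `PreTilt.untilt : 𝒪♭ →* 𝒪` (`x ↦ x♯`, [Scholze–Weinstein, Berkeley Lectures]) and `(φ⁻ⁿ x)♯^{pⁿ} = x♯`, but
neither `IsDomain` as an instance nor `ValuationRing` for `PreTilt`. PROVED HERE over the sharp coordinates `x ↦ ((φ⁻ⁿx)♯)ₙ ∈ 𝒪_{ℂ_F}^ℕ`:
* `untilt_eq_zero_iff` : `x♯ = 0 ↔ x = 0`; `coeff_eq_mk_untilt` : `xₙ = (φ⁻ⁿx)♯ mod p`; `norm_untilt_symm_pow` : `‖(φ⁻ⁿx)♯‖^{pⁿ} = ‖x♯‖`.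
* **`dvd_of_norm_untilt_le` : `‖g♯‖ ≤ ‖f♯‖ ⟹ f ∣ g` in `𝒪_{ℂ_F}♭`** (the quotients `(φ⁻ⁿg)♯/(φ⁻ⁿf)♯` lie in the unit ball, are EXACTLY
  compatible under `p`-th powers, and reduce to a pre-image `h` with `f·h = g`); `norm_untilt_le_of_dvd` (converse).
* `isDomain_preTilt`, **`valuationRing_preTilt` : `𝒪_{ℂ_F}♭` is a valuation ring**; `isUnit_of_norm_untilt_eq_one`;
  `eq_zero_of_forall_pow_dvd` : a non-unit `a` of `𝒪_{ℂ_F}♭` is adically Hausdorff (`‖a♯‖ < 1`, so `‖c♯‖ ≤ ‖a♯‖ⁿ → 0`).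
* `isUnit_iff_norm_untilt_eq_one` : `(𝒪_{ℂ_F}♭)ˣ = {‖a♯‖ = 1}`; `isPrime_of_mem_frobeniusFibre_preTilt` : §6.6's fibre
  `{([φⁿ(t)] − p) : n ∈ ℤ}` (E-t2's `Witt.frobeniusFibre`) consists of PRIME ideals for EVERY non-unit `t ≠ 0` (v2, §5).
* **`isPrime_span_teichSubP_preTilt`** : for every non-unit `a ≠ 0` of `𝒪_{ℂ_F}♭`, `([a] − p) ⊂ 𝔸_inf(F)` is PRIME, and
  **`prop621PrimeClaim_preTilt` : `Witt.Prop621PrimeClaim p 𝔪 ℓ⋆` HOLDS for EVERY PROPER ideal `𝔪 ⊂ 𝒪_{ℂ_F}♭`** and every `ℓ⋆` —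
  Joshi's Prop. 6.2.1 (2) at his literal ring, all `a`, all `j` (E-t62's `isPrime_jIdeal_pFlat_zero` is the instance `a = p♭`, `j = 1`).
Instance hypotheses `[Fact (¬ IsUnit (p : 𝒪_{ℂ_F}))]`, `[IsAdicComplete (p) 𝒪_{ℂ_F}]` are those of p442499 and are THEOREMS of the tree
for `‖p‖ < 1` (`not_isUnit_natCast_integerC`, `isAdicComplete_integerC_natCast`). HONEST SCOPE: Lemma 6.2.2 / [FF18, Cor. 2.2.9] (every
primitive degree-one element is a unit multiple of some `[a] − p`) is NOT touched; no untilt FIELD `K_y` or its valuation is built; this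
is tilting folklore ([Scholze–Weinstein], [FF18, §2.2]) reproved in kernel, not an adjudication. TYPED AS A CANDIDATE (D-0012): typed ≠
proved ≠ endorsed; **no side is taken** on [IUTchIII] Cor. 3.12, on Joshi's claims or on Mochizuki's report on them; nothing here bears
on S. No `def`, no instance, no notation, no FACT-LIST input, no `Cor312*`/`Thm311*` import (R14). [claim: Joshi2023ATS2Local, status: disputed]
-/

noncomputable section

namespace Summit.ABC.IUTFork.Joshi.Witt

open WittVector

section TiltIntegerC

open Literature.NumberTheory.PAdicHodge Literature.NumberTheory.GaloisRepresentations ValuativeRel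

variable {F : Type} [Field F] [ValuativeRel F] [TopologicalSpace F] [IsNonarchimedeanLocalField F]
  {p : ℕ} [hp : Fact p.Prime] [Fact (¬ IsUnit (p : integerC F))]
  [IsAdicComplete (Ideal.span {(p : integerC F)}) (integerC F)]

/-! ## 1. Sharp coordinates of the tilt `𝒪_{ℂ_F}♭ = PreTilt 𝒪_{ℂ_F} p` -/

/-- `0♯ = 0`. [folklore] -/
theorem untilt_zero : PreTilt.untilt (0 : PreTilt (integerC F) p) = 0 :=
  Perfection.teichmuller_zero

/-- **`xₙ = (φ⁻ⁿ x)♯ mod p`**: the `n`-th coordinate of an element of the tilt is the reduction of the sharp of its `pⁿ`-th root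
(Mathlib `PreTilt.mk_untilt_eq_coeff_zero` at `φ⁻ⁿ x`). [folklore] -/
theorem coeff_eq_mk_untilt (n : ℕ) (x : PreTilt (integerC F) p) :
    PreTilt.coeff n x =
      Ideal.Quotient.mk _ (PreTilt.untilt (((frobeniusEquiv (PreTilt (integerC F) p) p).symm)^[n] x)) := by
  rw [PreTilt.mk_untilt_eq_coeff_zero, PreTilt.coeff_iterate_frobeniusEquiv_symm, zero_add]

/-- `((φ⁻⁽ⁿ⁺¹⁾ x)♯)^p = (φ⁻ⁿ x)♯`: the sharp coordinates are EXACTLY compatible under `p`-th powers. [folklore] -/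
theorem untilt_symm_succ_pow (n : ℕ) (x : PreTilt (integerC F) p) :
    PreTilt.untilt (((frobeniusEquiv (PreTilt (integerC F) p) p).symm)^[n + 1] x) ^ p =
      PreTilt.untilt (((frobeniusEquiv (PreTilt (integerC F) p) p).symm)^[n] x) := by
  rw [Function.iterate_succ_apply', ← map_pow, frobeniusEquiv_symm_pow_p]

/-- **`x♯ = 0 ↔ x = 0`** (`𝒪_{ℂ_F}` is a domain: `((φ⁻ⁿx)♯)^{pⁿ} = x♯ = 0` kills every coordinate). [folklore] -/
theorem untilt_eq_zero_iff {x : PreTilt (integerC F) p} : PreTilt.untilt x = 0 ↔ x = 0 := by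
  refine ⟨fun h => Perfection.ext fun n => ?_, fun h => by rw [h, untilt_zero]⟩
  have hn : PreTilt.untilt (((frobeniusEquiv (PreTilt (integerC F) p) p).symm)^[n] x) = 0 := by
    have h' := PreTilt.untilt_iterate_frobeniusEquiv_symm_pow x n
    rw [h] at h'
    exact eq_zero_of_pow_eq_zero h'
  change PreTilt.coeff n x = PreTilt.coeff n (0 : PreTilt (integerC F) p)
  rw [map_zero, coeff_eq_mk_untilt, hn, map_zero]

/-- **`‖(φ⁻ⁿ x)♯‖^{pⁿ} = ‖x♯‖`** in `ℂ_F`. [folklore] -/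
theorem norm_untilt_symm_pow (n : ℕ) (x : PreTilt (integerC F) p) :
    ‖((PreTilt.untilt (((frobeniusEquiv (PreTilt (integerC F) p) p).symm)^[n] x) : integerC F) : CompletedAlgClosure F)‖ ^ p ^ n =
      ‖((PreTilt.untilt x : integerC F) : CompletedAlgClosure F)‖ := by
  rw [← norm_pow, ← Subring.coe_pow, PreTilt.untilt_iterate_frobeniusEquiv_symm_pow]

/-- `f ∣ g` in the tilt forces `‖g♯‖ ≤ ‖f♯‖` (`♯` is multiplicative and lands in the unit ball). [folklore] -/
theorem norm_untilt_le_of_dvd {f g : PreTilt (integerC F) p} (h : f ∣ g) :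
    ‖((PreTilt.untilt g : integerC F) : CompletedAlgClosure F)‖ ≤ ‖((PreTilt.untilt f : integerC F) : CompletedAlgClosure F)‖ := by
  obtain ⟨c, rfl⟩ := h
  rw [map_mul, Subring.coe_mul, norm_mul]
  exact mul_le_of_le_one_right (norm_nonneg _) (norm_coe_integerC_le _)

/-! ## 2. `𝒪_{ℂ_F}♭` is a valuation domain: division by sharp coordinates -/

/-- **`‖g♯‖ ≤ ‖f♯‖ ⟹ f ∣ g` in `𝒪_{ℂ_F}♭`.** For `f ≠ 0` the quotients `Hₙ = (φ⁻ⁿg)♯ / (φ⁻ⁿf)♯ ∈ ℂ_F` have norm `≤ 1` (take `pⁿ`-th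
roots of the hypothesis), satisfy `H_{n+1}^p = Hₙ` EXACTLY, and `h = (Hₙ mod p)ₙ ∈ 𝒪_{ℂ_F}♭` has `f·h = g` coordinatewise
(`xₙ = (φ⁻ⁿx)♯ mod p`). [folklore] -/
theorem dvd_of_norm_untilt_le {f g : PreTilt (integerC F) p}
    (h : ‖((PreTilt.untilt g : integerC F) : CompletedAlgClosure F)‖ ≤ ‖((PreTilt.untilt f : integerC F) : CompletedAlgClosure F)‖) : f ∣ g := by
  by_cases hf : f = 0
  · have hg : g = 0 := by
      rw [hf, untilt_zero, ZeroMemClass.coe_zero, norm_zero] at h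
      exact untilt_eq_zero_iff.1 (by exact_mod_cast norm_le_zero_iff.1 h)
    exact ⟨0, by rw [hg, mul_zero]⟩
  -- sharp coordinates
  set Fn : ℕ → integerC F := fun n => PreTilt.untilt (((frobeniusEquiv (PreTilt (integerC F) p) p).symm)^[n] f) with hFn
  set Gn : ℕ → integerC F := fun n => PreTilt.untilt (((frobeniusEquiv (PreTilt (integerC F) p) p).symm)^[n] g) with hGn
  have hF0 : ((PreTilt.untilt f : integerC F) : CompletedAlgClosure F) ≠ 0 := fun h0 =>
    hf (untilt_eq_zero_iff.1 (by exact_mod_cast h0))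
  have hFne : ∀ n, (Fn n : CompletedAlgClosure F) ≠ 0 := fun n h0 => hF0 (by
    rw [← norm_eq_zero, ← norm_untilt_symm_pow n f, norm_eq_zero.2 h0, zero_pow (pow_ne_zero n hp.out.ne_zero)])
  have hle : ∀ n, ‖(Gn n : CompletedAlgClosure F)‖ ≤ ‖(Fn n : CompletedAlgClosure F)‖ := fun n =>
    (pow_le_pow_iff_left₀ (norm_nonneg _) (norm_nonneg _) (pow_ne_zero n hp.out.ne_zero)).1
      (by rw [norm_untilt_symm_pow, norm_untilt_symm_pow]; exact h)
  have hmem : ∀ n, (Gn n : CompletedAlgClosure F) / (Fn n : CompletedAlgClosure F) ∈ integerC F := fun n => by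
    rw [mem_integerC_iff, norm_div]
    exact div_le_one_of_le₀ (hle n) (norm_nonneg _)
  -- the quotient sequence and its exact `p`-power compatibility
  have hFsucc : ∀ n, Fn (n + 1) ^ p = Fn n := fun n => untilt_symm_succ_pow n f
  have hGsucc : ∀ n, Gn (n + 1) ^ p = Gn n := fun n => untilt_symm_succ_pow n g
  set H : ℕ → integerC F := fun n => ⟨_, hmem n⟩ with hH
  have hFH : ∀ n, Fn n * H n = Gn n := fun n => Subtype.ext (by
    rw [Subring.coe_mul]
    change (Fn n : CompletedAlgClosure F) * ((Gn n : CompletedAlgClosure F) / (Fn n : CompletedAlgClosure F)) = Gn n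
    field_simp [hFne n])
  have hHp : ∀ n, H (n + 1) ^ p = H n := fun n => by
    have hFn0 : Fn n ≠ 0 := fun h0 => hFne n (by rw [h0]; rfl)
    refine mul_left_cancel₀ hFn0 ?_
    calc Fn n * H (n + 1) ^ p = (Fn (n + 1) * H (n + 1)) ^ p := by rw [mul_pow, hFsucc]
      _ = Gn n := by rw [hFH, hGsucc]
      _ = Fn n * H n := (hFH n).symm
  let hq : PreTilt (integerC F) p := ⟨fun n => Ideal.Quotient.mk _ (H n), fun n => by rw [← map_pow, hHp]⟩
  refine ⟨hq, Perfection.ext fun n => ?_⟩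
  change PreTilt.coeff n g = PreTilt.coeff n (f * hq)
  rw [map_mul]
  change PreTilt.coeff n g = PreTilt.coeff n f * Ideal.Quotient.mk _ (H n)
  rw [coeff_eq_mk_untilt n g, coeff_eq_mk_untilt n f, ← map_mul]
  exact congrArg _ (hFH n).symm

/-- **`𝒪_{ℂ_F}♭` is an integral domain** (`♯` is multiplicative, `x♯ = 0 ↔ x = 0`, and `𝒪_{ℂ_F} ⊂ ℂ_F` is a domain; cf. Mathlib's
`PreTilt.isDomain`, stated there relative to a `Valuation.Integers` datum). [folklore] -/
theorem isDomain_preTilt : IsDomain (PreTilt (integerC F) p) := by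
  haveI : Nontrivial (PreTilt (integerC F) p) := CharP.nontrivial_of_char_ne_one (R := PreTilt (integerC F) p) hp.out.ne_one
  haveI : NoZeroDivisors (PreTilt (integerC F) p) := ⟨fun {a b} hab => by
    have h := congrArg (PreTilt.untilt (O := integerC F) (p := p)) hab
    rw [map_mul, untilt_zero] at h
    rcases mul_eq_zero.1 h with h0 | h0
    · exact Or.inl (untilt_eq_zero_iff.1 h0)
    · exact Or.inr (untilt_eq_zero_iff.1 h0)⟩
  exact NoZeroDivisors.to_isDomain _

/-- **`𝒪_{ℂ_F}♭` is a VALUATION RING**: for any `f, g`, comparing `‖f♯‖` and `‖g♯‖` in `ℝ` gives `f ∣ g` or `g ∣ f`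
(`dvd_of_norm_untilt_le`). The `IsDomain` instance argument is `isDomain_preTilt` (any proof). [folklore] -/
theorem valuationRing_preTilt [IsDomain (PreTilt (integerC F) p)] : ValuationRing (PreTilt (integerC F) p) := by
  refine { cond' := fun f g => ?_ }
  rcases le_total ‖((PreTilt.untilt g : integerC F) : CompletedAlgClosure F)‖ ‖((PreTilt.untilt f : integerC F) : CompletedAlgClosure F)‖ with h | h
  · obtain ⟨c, hc⟩ := dvd_of_norm_untilt_le h
    exact ⟨c, Or.inl hc.symm⟩
  · obtain ⟨c, hc⟩ := dvd_of_norm_untilt_le h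
    exact ⟨c, Or.inr hc.symm⟩

/-- An element of the tilt whose sharp has norm `1` is a UNIT (it divides `1`). [folklore] -/
theorem isUnit_of_norm_untilt_eq_one {a : PreTilt (integerC F) p}
    (h : ‖((PreTilt.untilt a : integerC F) : CompletedAlgClosure F)‖ = 1) : IsUnit a :=
  isUnit_of_dvd_one (dvd_of_norm_untilt_le (by rw [h, map_one, OneMemClass.coe_one, norm_one]))

/-- A NON-unit of the tilt has `‖a♯‖ < 1`. [folklore] -/
theorem norm_untilt_lt_one_of_not_isUnit {a : PreTilt (integerC F) p} (ha : ¬ IsUnit a) :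
    ‖((PreTilt.untilt a : integerC F) : CompletedAlgClosure F)‖ < 1 :=
  lt_of_le_of_ne (norm_coe_integerC_le _) fun h => ha (isUnit_of_norm_untilt_eq_one h)

/-- **Every non-unit of `𝒪_{ℂ_F}♭` is adically Hausdorff**: `(∀ n, aⁿ ∣ c) ⟹ c = 0` (`‖c♯‖ ≤ ‖a♯‖ⁿ → 0`; rank one). This is the
hypothesis `hH` of `Witt.isPrime_span_teichSubP` / `Witt.prop621PrimeClaim_of_valuationRing`. [folklore] -/
theorem eq_zero_of_forall_pow_dvd {a c : PreTilt (integerC F) p} (ha : ¬ IsUnit a) (hc : ∀ n : ℕ, a ^ n ∣ c) : c = 0 := by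
  have hlt := norm_untilt_lt_one_of_not_isUnit ha
  by_contra hc0
  have hpos : 0 < ‖((PreTilt.untilt c : integerC F) : CompletedAlgClosure F)‖ :=
    norm_pos_iff.2 fun h0 => hc0 (untilt_eq_zero_iff.1 (by exact_mod_cast h0))
  obtain ⟨n, hn⟩ := exists_pow_lt_of_lt_one hpos hlt
  have hle := norm_untilt_le_of_dvd (hc n)
  rw [map_pow, Subring.coe_pow, norm_pow] at hle
  exact lt_irrefl _ (hle.trans_lt hn)

/-! ## 3. Prop. 6.2.1 (2) at `𝒪_{ℂ_F}♭`: every `([a] − p)`, `a ∈ 𝔪 ∖ {0}`, is prime in `𝔸_inf(F)` -/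

/-- **For every non-unit `a ≠ 0` of `𝒪_{ℂ_F}♭`, the ideal `([a] − p) ⊂ 𝔸_inf(F) = 𝕎(𝒪_{ℂ_F}♭)` is PRIME** — p446240's
`Witt.isPrime_span_teichSubP` at the literal tilt (valuation domain, adically Hausdorff non-units). E-t62's `isPrime_jIdeal_pFlat_zero`
(`a = p♭`: `ker θ`) and its Frobenius translates are instances. [claim: Joshi2023ATS2Local, status: disputed] -/
theorem isPrime_span_teichSubP_preTilt {a : PreTilt (integerC F) p} (ha0 : a ≠ 0) (ha : ¬ IsUnit a) :
    (Ideal.span {teichSubP p a} : Ideal (Ainf (p := p) F)).IsPrime := by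
  haveI := isDomain_preTilt (F := F) (p := p)
  haveI := valuationRing_preTilt (F := F) (p := p)
  exact isPrime_span_teichSubP p ha0 ha fun c hc => eq_zero_of_forall_pow_dvd ha hc

/-- The quotient `𝔸_inf(F)/([a] − p)` — the ring of integers of the untilt `K_{y_a}` in [FF18]'s language — is an integral domain, for
every non-unit `a ≠ 0` of `𝒪_{ℂ_F}♭`. [folklore] -/
theorem isDomain_quotient_span_teichSubP_preTilt {a : PreTilt (integerC F) p} (ha0 : a ≠ 0) (ha : ¬ IsUnit a) :
    IsDomain (Ainf (p := p) F ⧸ (Ideal.span {teichSubP p a} : Ideal (Ainf (p := p) F))) :=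
  (Ideal.Quotient.isDomain_iff_prime _).2 (isPrime_span_teichSubP_preTilt ha0 ha)

/-- **[J-IIp] Prop. 6.2.1 (2) AT JOSHI'S LITERAL RING — `Witt.Prop621PrimeClaim p 𝔪 ℓ⋆` HOLDS for EVERY PROPER ideal `𝔪` of
`𝒪_{ℂ_F}♭`** (in particular Joshi's `𝔪_F`, the maximal ideal) and every `ℓ⋆`: for all `0 ≠ a ∈ 𝔪` and all `j = 1, …, ℓ⋆`, the ideal
`𝔭_j = ([a^{j²}] − p) ⊂ W(𝒪_{ℂ_F}♭)` is prime (p. 14 l. 57–59), WITHOUT the [FF18, Lem. 2.2.14] input of the printed proof (p. 15 l. 8–14).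
[claim: Joshi2023ATS2Local, status: disputed] -/
theorem prop621PrimeClaim_preTilt {𝔪 : Ideal (PreTilt (integerC F) p)} (h𝔪 : 𝔪 ≠ ⊤) (lstar : ℕ) :
    Prop621PrimeClaim p 𝔪 lstar := by
  haveI := isDomain_preTilt (F := F) (p := p)
  haveI := valuationRing_preTilt (F := F) (p := p)
  exact prop621PrimeClaim_of_valuationRing p h𝔪
    (fun a ha c hc => eq_zero_of_forall_pow_dvd (fun hu => h𝔪 (Ideal.eq_top_of_isUnit_mem 𝔪 ha hu)) hc) lstar

/-- In particular for the MAXIMAL ideal `𝔪_{ℂ_F♭}` (Joshi's `𝔪_F`; `𝒪_{ℂ_F}♭` is local, being a valuation domain).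
[claim: Joshi2023ATS2Local, status: disputed] -/
theorem prop621PrimeClaim_preTilt_maximalIdeal (lstar : ℕ) :
    haveI := isDomain_preTilt (F := F) (p := p)
    haveI := valuationRing_preTilt (F := F) (p := p)
    Prop621PrimeClaim p (IsLocalRing.maximalIdeal (PreTilt (integerC F) p)) lstar := by
  haveI := isDomain_preTilt (F := F) (p := p)
  haveI := valuationRing_preTilt (F := F) (p := p)
  exact prop621PrimeClaim_preTilt (IsLocalRing.maximalIdeal.isMaximal _).ne_top lstar

end TiltIntegerC

/-! ## 4. Unconditional form: the two instance hypotheses are theorems of the tree for `‖p‖_F < 1` -/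

section Unconditional

open Literature.NumberTheory.PAdicHodge Literature.NumberTheory.GaloisRepresentations ValuativeRel

variable {F : Type} [Field F] [ValuativeRel F] [TopologicalSpace F] [IsNonarchimedeanLocalField F] [CharZero F]
  {p : ℕ} [hp : Fact p.Prime]

/-- **[J-IIp] Prop. 6.2.1 (2) at `𝒪_{ℂ_F}♭`, ALL HYPOTHESES DISCHARGED**: for a `p`-adic local field `F` of characteristic `0` with
`‖p‖_F < 1` (i.e. of residue characteristic `p`; Joshi: `F = ℚ_p`), the instance data `p ∉ 𝒪_{ℂ_F}ˣ` and «`𝒪_{ℂ_F}` is `p`-adically complete» are the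
tree's `not_isUnit_natCast_integerC` / `isAdicComplete_integerC_natCast`, and `Witt.Prop621PrimeClaim p 𝔪 ℓ⋆` holds for every proper
ideal `𝔪 ⊂ 𝒪_{ℂ_F}♭` and every `ℓ⋆`. [claim: Joshi2023ATS2Local, status: disputed] -/
theorem prop621PrimeClaim_preTilt_of_valuation_lt_one (hp1 : valuation F p < 1) :
    haveI : Fact (¬ IsUnit (p : integerC F)) := ⟨not_isUnit_natCast_integerC hp1⟩
    ∀ {𝔪 : Ideal (PreTilt (integerC F) p)}, 𝔪 ≠ ⊤ → ∀ lstar : ℕ, Prop621PrimeClaim p 𝔪 lstar := by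
  haveI : Fact (¬ IsUnit (p : integerC F)) := ⟨not_isUnit_natCast_integerC hp1⟩
  haveI := isAdicComplete_integerC_natCast (F := F) hp1
  intro 𝔪 h𝔪 lstar
  exact prop621PrimeClaim_preTilt h𝔪 lstar

/-- … and `([a] − p)` is a prime ideal of `𝔸_inf(F)` for every non-unit `a ≠ 0` of `𝒪_{ℂ_F}♭`, `‖p‖_F < 1`.
[claim: Joshi2023ATS2Local, status: disputed] -/
theorem isPrime_span_teichSubP_preTilt_of_valuation_lt_one (hp1 : valuation F p < 1) :
    haveI : Fact (¬ IsUnit (p : integerC F)) := ⟨not_isUnit_natCast_integerC hp1⟩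
    ∀ {a : PreTilt (integerC F) p}, a ≠ 0 → ¬ IsUnit a →
      (Ideal.span {teichSubP p a} : Ideal (Ainf (p := p) F)).IsPrime := by
  haveI : Fact (¬ IsUnit (p : integerC F)) := ⟨not_isUnit_natCast_integerC hp1⟩
  haveI := isAdicComplete_integerC_natCast (F := F) hp1
  intro a ha0 ha
  exact isPrime_span_teichSubP_preTilt ha0 ha

end Unconditional

/-! ## 5. Units of the tilt via `♯`; §6.6's fibre `{([φⁿ(t)] − p) : n ∈ ℤ}` consists of PRIME ideals for every parameter `t` -/

section FibreAllParameters

open Literature.NumberTheory.PAdicHodge Literature.NumberTheory.GaloisRepresentations ValuativeRel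

variable {F : Type} [Field F] [ValuativeRel F] [TopologicalSpace F] [IsNonarchimedeanLocalField F]
  {p : ℕ} [hp : Fact p.Prime] [Fact (¬ IsUnit (p : integerC F))]
  [IsAdicComplete (Ideal.span {(p : integerC F)}) (integerC F)]

/-- **`a ∈ (𝒪_{ℂ_F}♭)ˣ ↔ ‖a♯‖ = 1`**: the maximal ideal of the valuation ring `𝒪_{ℂ_F}♭` (Joshi's `𝔪_F`) is `{a : ‖a♯‖ < 1}`. [folklore] -/
theorem isUnit_iff_norm_untilt_eq_one {a : PreTilt (integerC F) p} :
    IsUnit a ↔ ‖((PreTilt.untilt a : integerC F) : CompletedAlgClosure F)‖ = 1 := by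
  refine ⟨fun h => ?_, isUnit_of_norm_untilt_eq_one⟩
  obtain ⟨u, rfl⟩ := h
  have h1 : ‖((PreTilt.untilt (u : PreTilt (integerC F) p) : integerC F) : CompletedAlgClosure F)‖ *
      ‖((PreTilt.untilt (↑u⁻¹ : PreTilt (integerC F) p) : integerC F) : CompletedAlgClosure F)‖ = 1 := by
    rw [← norm_mul, ← Subring.coe_mul, ← map_mul, Units.mul_inv, map_one, OneMemClass.coe_one, norm_one]
  by_contra hne
  have hlt := lt_of_le_of_ne (norm_coe_integerC_le _) hne
  exact absurd h1 (mul_lt_one_of_nonneg_of_lt_one_left (norm_nonneg _) hlt (norm_coe_integerC_le _)).ne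

/-- **Non-units of `𝒪_{ℂ_F}♭` are exactly the `a` with `‖a♯‖ < 1`** (= the maximal ideal `𝔪_{ℂ_F♭}`). [folklore] -/
theorem not_isUnit_iff_norm_untilt_lt_one {a : PreTilt (integerC F) p} :
    ¬ IsUnit a ↔ ‖((PreTilt.untilt a : integerC F) : CompletedAlgClosure F)‖ < 1 := by
  rw [isUnit_iff_norm_untilt_eq_one, (norm_coe_integerC_le _).lt_iff_ne]

/-- A ring automorphism preserves non-units. [folklore] -/
theorem not_isUnit_ringEquiv_apply {R : Type*} [CommRing R] (e : R ≃+* R) {t : R} (ht : ¬ IsUnit t) : ¬ IsUnit (e t) :=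
  fun h => ht (by simpa using h.map e.symm)

/-- **§6.6 (p. 16 l. 30–41) for EVERY parameter**: for every non-unit `t ≠ 0` of `𝒪_{ℂ_F}♭`, EVERY member of the printed fibre
`{([φⁿ(t)] − p) : n ∈ ℤ}` — abc-iut-E-t2's `Witt.frobeniusFibre p t` (p442065) — is a PRIME ideal of `𝔸_inf(F)` («the set of prime ideals
generated by primitive irreducible elements of degree one»). E-t62's `isPrime_of_mem_frobeniusFibre_pFlat` is the case `t = p♭`; the members with
`n < 0` (the `pⁿ`-th ROOTS of `t`) are not instances of `Witt.Prop621PrimeClaim` and are covered here directly. [claim: Joshi2023ATS2Local, status: disputed] -/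
theorem isPrime_of_mem_frobeniusFibre_preTilt {t : PreTilt (integerC F) p} (ht0 : t ≠ 0) (ht : ¬ IsUnit t)
    {I : Ideal (Ainf (p := p) F)} (hI : I ∈ frobeniusFibre p t) : I.IsPrime := by
  obtain ⟨n, rfl⟩ := hI
  exact isPrime_span_teichSubP_preTilt ((frobeniusEquiv_zpow_ne_zero_iff p n t).2 ht0)
    (not_isUnit_ringEquiv_apply _ ht)

end FibreAllParameters

end Summit.ABC.IUTFork.Joshi.Witt

end
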